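import Mathlib
import Summits.CriticalPhenomena.CardyFormulaZ2.Theorems.CardyMagicRigidityPositiveConeDefs
import Summits.CriticalPhenomena.CardyFormulaZ2.Theorems.CardyMagicRigidityNestingRigidityOneGenerationZ2Interiors
import Literature.Probability.Percolation.InterfaceLoopWindingSign
import Literature.Probability.Percolation.FKLoopNestingIntegrable
import HarnessLib

/-!
# Lattice regularity of the bond-`ℤ²` loop ensemble (line `positive-cone-weight-doubling`)

Crux `Summit.CriticalPhenomena.CardyFormulaZ2.Theses.CardyMagicRigidity.NestingRigidity`
(stmt-CriticalPhenomena-4835), line `positive-cone-weight-doubling`, helper toward the registered stub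
`stub_precompactness : PrecompactRegular zEns ∧ PrecompactRegular tEns` (and `stub_treeRigidity`):
the lattice half of "regularity passes to `d_CN`-limits" on the bond side.  At every positive mesh `δ`
and for EVERY bond configuration `ω`, the typed loop representation `zEns.X δ ω = bondLoopConfig δ 0 ω`
(DKKMO's medial interface loops) satisfies three of the five fields of `Regular`:

* `degreeOne_zEns` — covering degree one: every loop winds `0` or `±1` times about every point
  (`IsInterfaceLoop.wind_mem_and_loopSignedArea` at mesh `1`, rescaled by `wind_loopCurve_mesh`);
* `laminar_zEns` — winding interiors of two loops are nested or disjoint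
  (`interfaceLoop_interiors_nested_or_disjoint_mesh`);
* `locallyFinite_zEns` — finitely many loops meet every ball (`ncard_loops_meeting_le`).

The two remaining fields (`boundary`: trace = frontier of the winding interior, from the jump of the
winding number across every dart; `separating`: a medial interface loop is determined by its winding
interior) are not treated here.
-/

noncomputable section

open MeasureTheory Set Filter Metric
open scoped Real Topology BigOperators

namespace Summit.CriticalPhenomena.CardyFormulaZ2.Cruxes.NestingRigidity.PositiveConeWeightDoubling

open Literature.Probability.RandomPlanarGeometry Literature.Probability.Percolation
  Literature.Probability.LatticeModels
open Summit.CriticalPhenomena.CardyFormulaZ2.Cruxes.NestingRigidity.RingCloudTomography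
open Summit.CriticalPhenomena.CardyFormulaZ2.Cruxes.NestingRigidity.MarkovCascadeOneGeneration

/-- Membership in the loops (both types) of `zEns` at mesh `δ`, unfolded: the unbased loops of the
medial interface loops of `ω`. -/
theorem mem_loops_zEns_iff {δ : ℝ} {ω : BondConfig (Site 2)} {u : UnbasedLoop ℂ} :
    u ∈ (zEns.X δ ω).loops ↔ ∃ (γ : List MedialVertex) (h : IsInterfaceLoop ω γ),
      u = UnbasedLoop.mk (BasedLoop.mk (loopCurve δ 0 γ) (isLoop_loopCurve δ 0 h.ne_nil)) := by
  constructor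
  · rintro (⟨γ, hγ, -, rfl⟩ | ⟨γ, hγ, -, rfl⟩) <;> exact ⟨γ, hγ, rfl⟩
  · rintro ⟨γ, hγ, rfl⟩
    have h01 : ∀ t : Fin 2, t = 0 ∨ t = 1 := by decide
    rcases h01 (loopType γ) with ht | ht
    · exact Or.inl ⟨γ, hγ, ht, rfl⟩
    · exact Or.inr ⟨γ, hγ, ht, rfl⟩

/-- The winding number of the unbased loop of a loop class is that of the class. -/
theorem wind_mk_mk (c : CurveClass ℂ) (hc : c.IsLoop) (z : ℂ) :
    (UnbasedLoop.mk (BasedLoop.mk c hc)).wind z = c.wind z :=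
  rfl

/-- **Covering degree one on bond-`ℤ²`** (field `Regular.degreeOne` at the lattice level): at mesh
`δ > 0`, every loop of `zEns.X δ ω` winds `0`, `1` or `-1` times about every point. -/
theorem degreeOne_zEns : ∀ {δ : ℝ}, 0 < δ → ∀ (ω : BondConfig (Site 2)), ∀ u ∈ (zEns.X δ ω).loops, ∀ z : ℂ, u.wind z = 0 ∨ u.wind z = 1 ∨ u.wind z = -1 := by
  intro δ hδ ω u hu z
  obtain ⟨γ, hγ, rfl⟩ := mem_loops_zEns_iff.1 hu
  rw [wind_mk_mk, wind_loopCurve_mesh hδ.ne' γ z]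
  rcases hγ.wind_mem_and_loopSignedArea with ⟨hw, -⟩ | ⟨hw, -⟩
  · rcases hw (z / δ) with h | h
    · exact Or.inl h
    · exact Or.inr (Or.inl h)
  · rcases hw (z / δ) with h | h
    · exact Or.inl h
    · exact Or.inr (Or.inr h)

/-- **Laminarity on bond-`ℤ²`** (field `Regular.laminar` at the lattice level): at mesh `δ > 0`, the
winding interiors of two loops of `zEns.X δ ω` are nested or disjoint
(`interfaceLoop_interiors_nested_or_disjoint_mesh`). -/
theorem laminar_zEns : ∀ {δ : ℝ}, 0 < δ → ∀ (ω : BondConfig (Site 2)), ∀ u ∈ (zEns.X δ ω).loops, ∀ v ∈ (zEns.X δ ω).loops, {z | u.wind z ≠ 0} ⊆ {z | v.wind z ≠ 0} ∨ {z | v.wind z ≠ 0} ⊆ {z | u.wind z ≠ 0} ∨ Disjoint {z | u.wind z ≠ 0} {z | v.wind z ≠ 0} := by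
  intro δ hδ ω u hu v hv
  obtain ⟨γ, hγ, rfl⟩ := mem_loops_zEns_iff.1 hu
  obtain ⟨γ', hγ', rfl⟩ := mem_loops_zEns_iff.1 hv
  simp only [wind_mk_mk]
  exact interfaceLoop_interiors_nested_or_disjoint_mesh hδ.ne' hγ hγ'

/-- **Local finiteness on bond-`ℤ²`** (field `Regular.locallyFinite` at the lattice level): at mesh
`δ > 0`, only finitely many loops of each type of `zEns.X δ ω` have their trace in a window `B(0, r)`
(they meet `B̄(0, r)`: `ncard_loops_meeting_le`). -/
theorem locallyFinite_zEns : ∀ {δ : ℝ}, 0 < δ → ∀ (ω : BondConfig (Site 2)), (zEns.X δ ω).IsLocallyFinite := by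
  intro δ hδ ω
  refine LoopConfig.IsLocallyFinite.of_finite_window fun i r ↦ ?_
  refine (ncard_loops_meeting_le hδ r ω).1.subset ?_
  rintro u ⟨hu, hr⟩
  refine ⟨LoopConfig.subset_loops _ i hu, ?_⟩
  obtain ⟨x, hx⟩ := u.range_nonempty
  exact ⟨x, hx, ball_subset_closedBall (hr hx)⟩

end Summit.CriticalPhenomena.CardyFormulaZ2.Cruxes.NestingRigidity.PositiveConeWeightDoubling

end
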